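import Mathlib.Tactic
import HarnessLib

/-!
# Kozma–Nitzan's Question 8 — LEMMA Ψ₀: the two-level subtree bound at the leaf class, `δ₀ ≤ c·μ̂₀` (gen 43)

Support file (`--supports stmt-CriticalPhenomena-4575`, closed crux; independent mathematics on Kozma–Nitzan's Question 8,
arXiv:2401.12397 §5.5 p. 36), prover `prim-ineq-gen-6` (gen 43).  No definitions, no named facts, no sorries; standard axioms.
Memo `run/shared/lean/prim/prim-ineq-gen-6/PROOF-DRED-G43.md` §6 (LEMMA Ψ₀).

Root class `0` of a path-end block: root marks `a = A₀`, `g = C₀`, first edge weight `s = s₁`, suffix `T₁` with channels `u₁` (C-good, A-bad), `v₁` (A-good,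
C-bad), `m₁` (both good), `p = Φ(T₁) = u₁ + v₁ + m₁ ≤ 1`.  The block moments are then `ε = a(p − su₁)`, `π = g(p − sv₁)`, `m = ag(p − s(u₁+v₁))`,
`Φ = ε + π − m`, `D = ε − m`, `ϖ = πΦ − m`, `cΦ = Dϖ` (`c ≥ 0 ⟺ ϖ ≥ 0`), `σ = π + m`, `K₄ = (Φ+m)(1−Φ)`, and the level-0 density of class 0 is
`ψ₀ = y₀ + β₀ = c·p·(a+g−ag) − ag[K₄p − Φσ(1−p)]`, while `c·μ̂₀ = c·p·a·g`.
THEOREM UB (gen 28) gives `U₀ = x₀ + ψ₀ ≤ cμ̂₀`; LEMMA Ψ₀ is the two-level companion `ψ₀ ≤ cμ̂₀`, i.e. `δ₀ = max(U₀, ψ₀) ≤ cμ̂₀` (UB(δ) at the leaf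
class): the level-1 deficit `x₀⁻` is paid by the THEOREM K-c slack `s₁·Kc₀`.  Proof: the exact identity
`Φ(cμ̂₀ − ψ₀) = Φ(T1 + P5 + P6 + P7 − debt) + T3′ + T4′ − E·(cΦ − Dϖ)` (the K-c four-term decomposition at depth 0 plus `x₀`), the signs
`T3′, T4′, P6, P7 ≥ 0`, `T1 ≥ −N`, and the one inequality `debt + N ≤ P5` (`c ≤ Dπ ≤ Φ·D`, and `ā·D/a + s a ḡ u₁ ≤ 1 − Φ`).

* `kPsi0_identity` — the polynomial identity (free variables, `linear_combination`);
* `kPsi0_c_le` — `cΦ = D(πΦ − m)`, `m, D ≥ 0`, `Φ > 0` give `c ≤ Dπ`;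
* `kPsi0_debt` — `debt + N ≤ P5`;
* `kPsi0_main` — LEMMA Ψ₀: `ψ₀ ≤ c·p·a·g` for all admissible `(a, g, s, u₁, v₁, m₁)` and `c` with `cΦ = Dϖ`, `ϖ ≥ 0`, `Φ > 0`.
[cite: KozmaNitzan2024, Question 8 (§5.5 p. 36)]
-/

namespace Summit.CriticalPhenomena.PercolationContinuityZ3.Theorems

namespace PocketCert

/-- **LEMMA Ψ₀, the exact identity.**  With the block moments of a root class written in the suffix channels (all products expanded in the statement),
`Φ(c p a g − ψ₀) = Φ(T1 + P5 + P6 + P7 − debt) + T3′ + T4′ − E(cΦ − Dϖ)` as a polynomial identity in the free variables `a g s u₁ v₁ m₁ c`.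
[cite: KozmaNitzan2024, Question 8 (§5.5 p. 36)] -/
theorem kPsi0_identity (a g s u1 v1 m1 c : ℝ) :
    let p := u1 + v1 + m1
    let pi := g * (p - s * v1)
    let m := a * g * (p - s * (u1 + v1))
    let D := a * ((1 - g) * (p - s * u1) + g * s * v1)
    let Φ := pi + D
    let ϖ := pi * Φ - m
    let ψ0 := c * p * (a + g - a * g) - a * g * ((Φ + m) * (1 - Φ) * p - Φ * (pi + m) * (1 - p))
    let fv := s * a * g * v1
    let uN := g * (1 - a) * (p - s * v1)
    let T1 := s * a * u1 * (1 - g) * (Φ * pi - c - Φ * fv)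
    let T3' := fv * uN * (D * Φ + m)
    let T4' := a * (1 - g) * (p - s * u1) * ϖ * (a * g * (p - s * v1))
    let P5 := s * g * v1 * a * Φ * (1 - Φ)
    let P6 := (1 - a) * a * g * (p - s * (u1 + v1)) * D
    let P7 := Φ * (pi + m) * a * (1 - p) * (1 - g)
    let debt := (1 - a) * g * s * v1 * c
    let E := p * (a * (1 - g) + g * (1 - a)) - s * (a * (1 - g) * u1 + g * (1 - a) * v1)
    Φ * (c * p * a * g - ψ0) = Φ * (T1 + P5 + P6 + P7 - debt) + T3' + T4' - E * (c * Φ - D * ϖ) := by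
  intro p pi m D Φ ϖ ψ0 fv uN T1 T3' T4' P5 P6 P7 debt E
  simp only [p, pi, m, D, Φ, ϖ, ψ0, fv, uN, T1, T3', T4', P5, P6, P7, debt, E]
  ring

/-- **`c ≤ D·π`.**  From `cΦ = D(πΦ − m)` with `D, m ≥ 0` and `Φ > 0`.
[cite: KozmaNitzan2024, Question 8 (§5.5 p. 36)] -/
theorem kPsi0_c_le (c D pi m Φ : ℝ) (hc : c * Φ = D * (pi * Φ - m)) (hD : 0 ≤ D) (hm : 0 ≤ m) (hΦ : 0 < Φ) :
    c ≤ D * pi := by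
  have h1 : c * Φ ≤ D * pi * Φ := by rw [hc]; nlinarith [mul_nonneg hD hm]
  exact le_of_mul_le_mul_right h1 hΦ

/-- **The one inequality of LEMMA Ψ₀: `debt + N ≤ P5`.**  With `W = g s v₁ ≥ 0`, `debt = ā·W·c`, `N = W·aΦ·q` (`q = s a ḡ u₁`),
`P5 = W·aΦ·(1−Φ)`: since `c ≤ Dπ`, `D = a·X₀`, `π ≤ Φ` and `ā X₀ + q ≤ 1 − Φ`, one gets `debt + N ≤ W·aΦ(āX₀ + q) ≤ P5`.
[cite: KozmaNitzan2024, Question 8 (§5.5 p. 36)] -/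
theorem kPsi0_debt (W a ab X0 q c D pi Φ : ℝ) (hW : 0 ≤ W) (ha : 0 ≤ a) (hab : 0 ≤ ab) (hX0 : 0 ≤ X0) (hpi : 0 ≤ pi)
    (hD : D = a * X0) (hc : c ≤ D * pi) (hpiΦ : pi ≤ Φ) (hq : ab * X0 + q ≤ 1 - Φ) :
    ab * W * c + W * (a * Φ) * q ≤ W * (a * Φ) * (1 - Φ) := by
  have h1 : ab * W * c ≤ ab * W * (D * pi) := mul_le_mul_of_nonneg_left hc (mul_nonneg hab hW)
  have h2 : ab * W * (D * pi) = W * a * (ab * X0) * pi := by rw [hD]; ring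
  have h3 : W * a * (ab * X0) * pi ≤ W * a * (ab * X0) * Φ :=
    mul_le_mul_of_nonneg_left hpiΦ (mul_nonneg (mul_nonneg hW ha) (mul_nonneg hab hX0))
  have h4 : W * (a * Φ) * (ab * X0 + q) ≤ W * (a * Φ) * (1 - Φ) := by
    apply mul_le_mul_of_nonneg_left hq
    exact mul_nonneg hW (mul_nonneg ha (le_trans hpi hpiΦ))
  nlinarith

/-- **LEMMA Ψ₀ identity, named form.**  The same identity with the block moments as named variables bound by their defining equations.
[cite: KozmaNitzan2024, Question 8 (§5.5 p. 36)] -/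
theorem kPsi0_identity_named (a g s u1 v1 m1 c p pi m X0 D Φ ϖ ψ0 : ℝ)
    (hp : p = u1 + v1 + m1) (hpi : pi = g * (p - s * v1)) (hm : m = a * g * (p - s * (u1 + v1)))
    (hX0 : X0 = (1 - g) * (p - s * u1) + g * s * v1) (hD : D = a * X0) (hΦ : Φ = pi + D) (hϖ : ϖ = pi * Φ - m)
    (hψ : ψ0 = c * p * (a + g - a * g) - a * g * ((Φ + m) * (1 - Φ) * p - Φ * (pi + m) * (1 - p))) :
    Φ * (c * p * a * g - ψ0)
      = Φ * (s * a * u1 * (1 - g) * (Φ * pi - c)) - Φ * ((g * s * v1) * (a * Φ) * (s * a * (1 - g) * u1))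
        + Φ * ((g * s * v1) * (a * Φ) * (1 - Φ)) + Φ * ((1 - a) * a * g * (p - s * (u1 + v1)) * D)
        + Φ * (Φ * (pi + m) * a * (1 - p) * (1 - g)) - Φ * ((1 - a) * (g * s * v1) * c)
        + (s * a * g * v1) * (g * (1 - a) * (p - s * v1)) * (D * Φ + m)
        + a * (1 - g) * (p - s * u1) * ϖ * (a * g * (p - s * v1))
        - (p * (a * (1 - g) + g * (1 - a)) - s * (a * (1 - g) * u1 + g * (1 - a) * v1)) * (c * Φ - D * ϖ) := by
  subst hψ hϖ hΦ hD hX0 hm hpi hp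
  ring

/-- **LEMMA Ψ₀ assembly (abstract).**  From the identity and the signs: `Φ X = ΦT1 − ΦN + ΦP5 + ΦP6 + ΦP7 − Φ·debt + T3 + T4`, `Φ > 0`,
`T1, P6, P7, T3, T4 ≥ 0`, `debt + N ≤ P5` give `X ≥ 0`.
[cite: KozmaNitzan2024, Question 8 (§5.5 p. 36)] -/
theorem kPsi0_assemble (Φ X T1 N P5 P6 P7 debt T3 T4 : ℝ) (hΦ : 0 < Φ)
    (hid : Φ * X = Φ * T1 - Φ * N + Φ * P5 + Φ * P6 + Φ * P7 - Φ * debt + T3 + T4)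
    (h1 : 0 ≤ T1) (h2 : debt + N ≤ P5) (h3 : 0 ≤ P6) (h4 : 0 ≤ P7) (h5 : 0 ≤ T3) (h6 : 0 ≤ T4) : 0 ≤ X := by
  have e : 0 ≤ Φ * (T1 + (P5 - N - debt) + P6 + P7) :=
    mul_nonneg hΦ.le (by linarith)
  have e2 : 0 ≤ Φ * X := by rw [hid]; nlinarith
  exact (mul_nonneg_iff_of_pos_left hΦ).mp e2

/-- **LEMMA Ψ₀ (`δ₀ ≤ c·μ̂₀` at the leaf class; two-level companion of THEOREM UB).**  For every admissible root step
(`0 ≤ a, g ≤ 1`, `0 ≤ s ≤ 1`, `u₁, v₁, m₁ ≥ 0`, `p = u₁+v₁+m₁ ≤ 1`, `Φ > 0`) and every `c` with `cΦ = Dϖ`, `ϖ ≥ 0` (i.e. `c ≥ 0`):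
`ψ₀ = c p (a+g−ag) − ag[(Φ+m)(1−Φ)p − Φ(π+m)(1−p)] ≤ c·p·a·g`.  Hence `δ₀ = max(U₀, ψ₀) ≤ cμ̂₀` (with THEOREM UB for `U₀`).
The block moments are passed as named variables with their defining equations.
[cite: KozmaNitzan2024, Question 8 (§5.5 p. 36)] -/
theorem kPsi0_main (a g s u1 v1 m1 c p pi m X0 D Φ ϖ ψ0 : ℝ)
    (hp : p = u1 + v1 + m1) (hpi : pi = g * (p - s * v1)) (hm : m = a * g * (p - s * (u1 + v1)))
    (hX0 : X0 = (1 - g) * (p - s * u1) + g * s * v1) (hD : D = a * X0) (hΦ : Φ = pi + D) (hϖ : ϖ = pi * Φ - m)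
    (hψ : ψ0 = c * p * (a + g - a * g) - a * g * ((Φ + m) * (1 - Φ) * p - Φ * (pi + m) * (1 - p)))
    (ha0 : 0 ≤ a) (ha1 : a ≤ 1) (hg0 : 0 ≤ g) (hg1 : g ≤ 1) (hs0 : 0 ≤ s) (hs1 : s ≤ 1)
    (hu : 0 ≤ u1) (hv : 0 ≤ v1) (hm1 : 0 ≤ m1) (hp1 : p ≤ 1)
    (hΦpos : 0 < Φ) (hϖpos : 0 ≤ ϖ) (hc : c * Φ = D * ϖ) :
    ψ0 ≤ c * p * a * g := by
  -- basic signs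
  have hab : 0 ≤ 1 - a := by linarith
  have hgb : 0 ≤ 1 - g := by linarith
  have hsu : s * u1 ≤ u1 := mul_le_of_le_one_left hu hs1
  have hsv : s * v1 ≤ v1 := mul_le_of_le_one_left hv hs1
  have hpsu : 0 ≤ p - s * u1 := by rw [hp]; linarith
  have hpsv : 0 ≤ p - s * v1 := by rw [hp]; linarith
  have hsuv : s * (u1 + v1) ≤ u1 + v1 := mul_le_of_le_one_left (by linarith) hs1
  have hpsuv : 0 ≤ p - s * (u1 + v1) := by rw [hp]; linarith
  have hgsv : 0 ≤ g * s * v1 := mul_nonneg (mul_nonneg hg0 hs0) hv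
  have hX0pos : 0 ≤ X0 := by rw [hX0]; exact add_nonneg (mul_nonneg hgb hpsu) hgsv
  have hDpos : 0 ≤ D := by rw [hD]; exact mul_nonneg ha0 hX0pos
  have hpipos : 0 ≤ pi := by rw [hpi]; exact mul_nonneg hg0 hpsv
  have hmpos : 0 ≤ m := by rw [hm]; exact mul_nonneg (mul_nonneg ha0 hg0) hpsuv
  have hpiΦ : pi ≤ Φ := by rw [hΦ]; linarith
  have hDΦ : D ≤ Φ := by rw [hΦ]; linarith
  have hc' : c * Φ = D * (pi * Φ - m) := by rw [hc, hϖ]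
  have hcle : c ≤ D * pi := kPsi0_c_le c D pi m Φ hc' hDpos hmpos hΦpos
  have hcΦpi : c ≤ Φ * pi := le_trans hcle (mul_le_mul_of_nonneg_right hDΦ hpipos)
  -- 1 - Φ closed form and the bound (1-a) X0 + q ≤ 1 - Φ
  have h1Φ : 1 - Φ = (1 - p) * (a + g - a * g) + (1 - a) * (1 - g) + s * a * (1 - g) * u1 + s * g * (1 - a) * v1 := by
    rw [hΦ, hD, hX0, hpi]; ring
  have hq : (1 - a) * X0 + s * a * (1 - g) * u1 ≤ 1 - Φ := by
    have hM : 0 ≤ a + g - a * g := by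
      have h := mul_nonneg ha0 hgb
      have e : a * (1 - g) = a - a * g := by ring
      linarith
    have e1 : 0 ≤ (1 - p) * (a + g - a * g) := mul_nonneg (by linarith) hM
    have hsu0 : 0 ≤ s * u1 := mul_nonneg hs0 hu
    have e2 : 0 ≤ (1 - a) * (1 - g) * (1 - p + s * u1) :=
      mul_nonneg (mul_nonneg hab hgb) (by linarith)
    have e3 : (1 - Φ) - ((1 - a) * X0 + s * a * (1 - g) * u1)
        = (1 - p) * (a + g - a * g) + (1 - a) * (1 - g) * (1 - p + s * u1) := by rw [h1Φ, hX0]; ring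
    linarith
  -- debt + N ≤ P5  (N = (g s v1)(aΦ)(s a (1-g) u1))
  have hdebt := kPsi0_debt (g * s * v1) a (1 - a) X0 (s * a * (1 - g) * u1) c D pi Φ hgsv ha0 hab hX0pos hpipos hD hcle hpiΦ hq
  -- nonnegative terms
  have hT1N : 0 ≤ s * a * u1 * (1 - g) * (Φ * pi - c) :=
    mul_nonneg (mul_nonneg (mul_nonneg (mul_nonneg hs0 ha0) hu) hgb) (by linarith)
  have hT3 : 0 ≤ (s * a * g * v1) * (g * (1 - a) * (p - s * v1)) * (D * Φ + m) :=
    mul_nonneg (mul_nonneg (mul_nonneg (mul_nonneg (mul_nonneg hs0 ha0) hg0) hv) (mul_nonneg (mul_nonneg hg0 hab) hpsv))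
      (add_nonneg (mul_nonneg hDpos hΦpos.le) hmpos)
  have hT4 : 0 ≤ a * (1 - g) * (p - s * u1) * ϖ * (a * g * (p - s * v1)) :=
    mul_nonneg (mul_nonneg (mul_nonneg (mul_nonneg ha0 hgb) hpsu) hϖpos) (mul_nonneg (mul_nonneg ha0 hg0) hpsv)
  have hP6 : 0 ≤ (1 - a) * a * g * (p - s * (u1 + v1)) * D :=
    mul_nonneg (mul_nonneg (mul_nonneg (mul_nonneg hab ha0) hg0) hpsuv) hDpos
  have hP7 : 0 ≤ Φ * (pi + m) * a * (1 - p) * (1 - g) :=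
    mul_nonneg (mul_nonneg (mul_nonneg (mul_nonneg hΦpos.le (by linarith)) ha0) (by linarith)) hgb
  -- the exact identity (named form)
  have hid := kPsi0_identity_named a g s u1 v1 m1 c p pi m X0 D Φ ϖ ψ0 hp hpi hm hX0 hD hΦ hϖ hψ
  have hcorr : c * Φ - D * ϖ = 0 := by linarith [hc]
  rw [hcorr, mul_zero, sub_zero] at hid
  have hX := kPsi0_assemble Φ (c * p * a * g - ψ0) _ _ _ _ _ _ _ _ hΦpos hid hT1N hdebt hP6 hP7 hT3 hT4
  linarith

end PocketCert

end Summit.CriticalPhenomena.PercolationContinuityZ3.Theorems
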